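import Summits.CriticalPhenomena.PercolationContinuityZ3.Theorems.PercNearOneGluingNoHeavyPcintKernNFZ4B8Check1
import Summits.CriticalPhenomena.PercolationContinuityZ3.Theorems.PercNearOneGluingNoHeavyPcintKernNFZ4B8Check2
import Summits.CriticalPhenomena.PercolationContinuityZ3.Theorems.PercNearOneGluingNoHeavyPcintKernNFZ4B8Check3
import Summits.CriticalPhenomena.PercolationContinuityZ3.Theorems.PercNearOneGluingNoHeavyPcintKernNFZ4B8Check4
import Summits.CriticalPhenomena.PercolationContinuityZ3.Theorems.PercNearOneGluingNoHeavyPcintKernNFZ4B8Check5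
import Summits.CriticalPhenomena.PercolationContinuityZ3.Theorems.PercNearOneGluingNoHeavyPcintKernNFZ4B8Check6
import Summits.CriticalPhenomena.PercolationContinuityZ3.Theorems.PercNearOneGluingNoHeavyPcintKernNFZ4B8Check7
import Summits.CriticalPhenomena.PercolationContinuityZ3.Theorems.PercNearOneGluingNoHeavyPcintKernNFZ4B8Check8
import Summits.CriticalPhenomena.PercolationContinuityZ3.Theorems.PercNearOneGluingNoHeavyPcintKernNFZ4B8Check9
import Summits.CriticalPhenomena.PercolationContinuityZ3.Theorems.PercNearOneGluingNoHeavyPcintKernNFZ4B8Check10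
import Summits.CriticalPhenomena.PercolationContinuityZ3.Theorems.PercNearOneGluingNoHeavyPcintKernNFZ4B8Check11
import Summits.CriticalPhenomena.PercolationContinuityZ3.Theorems.PercNearOneGluingNoHeavyPcintKernNFZ4B8Check12
import Summits.CriticalPhenomena.PercolationContinuityZ3.Theorems.PercNearOneGluingNoHeavyPcintKernNFZ4B8Check13
import Summits.CriticalPhenomena.PercolationContinuityZ3.Theorems.PercNearOneGluingNoHeavyPcintKernNFZ4B8Check14
import Summits.CriticalPhenomena.PercolationContinuityZ3.Theorems.PercNearOneGluingNoHeavyPcintKernNFZ4B8Check15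
import Summits.CriticalPhenomena.PercolationContinuityZ3.Theorems.PercNearOneGluingNoHeavyPcintKernNFZ4B8Check16
import Summits.CriticalPhenomena.PercolationContinuityZ3.Theorems.PercNearOneGluingNoHeavyPcintKernNFZ4B8Check17
import Summits.CriticalPhenomena.PercolationContinuityZ3.Theorems.PercNearOneGluingNoHeavyPcintKernNFZ4B8Check18
import Summits.CriticalPhenomena.PercolationContinuityZ3.Theorems.PercNearOneGluingNoHeavyPcintKernNFZ4B8Check19
import Summits.CriticalPhenomena.PercolationContinuityZ3.Theorems.PercNearOneGluingNoHeavyPcintKernNFZ4B8Check20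
import Summits.CriticalPhenomena.PercolationContinuityZ3.Theorems.PercNearOneGluingNoHeavyPcintKernNFZ4B8Check21
import Summits.CriticalPhenomena.PercolationContinuityZ3.Theorems.PercNearOneGluingNoHeavyPcintKernNFZ4B8Check22
import Summits.CriticalPhenomena.PercolationContinuityZ3.Theorems.PercNearOneGluingNoHeavyPcintKernNFZ4B8Check23
import Summits.CriticalPhenomena.PercolationContinuityZ3.Theorems.PercNearOneGluingNoHeavyPcintKernNFZ4B8Check24
import Summits.CriticalPhenomena.PercolationContinuityZ3.Theorems.PercNearOneGluingNoHeavyPcintKernNFZ4B8Check25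
import Summits.CriticalPhenomena.PercolationContinuityZ3.Theorems.PercNearOneGluingNoHeavyPcintKernNFZ4B8Check26
import Summits.CriticalPhenomena.PercolationContinuityZ3.Theorems.PercNearOneGluingNoHeavyPcintKernNFZ4B8Check27
import Summits.CriticalPhenomena.PercolationContinuityZ3.Theorems.PercNearOneGluingNoHeavyPcintKernNFZ4B8Check28
import Summits.CriticalPhenomena.PercolationContinuityZ3.Theorems.PercNearOneGluingNoHeavyPcintKernNFZ4B8Check29
import Summits.CriticalPhenomena.PercolationContinuityZ3.Theorems.PercNearOneGluingNoHeavyPcintKernNFZ4B8Check30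
import HarnessLib

/-!
# PCINT lane: `p_c^bond(ℤ⁴) ≥ 0.1505` (kernel-checked B3r window certificate on normal forms, memory 8 (7-step windows; 9696 first-use normal forms of 2097152 codes); printed best lower bound 0.1470 (Pönitz–Tittmann 2000 + Hammersley)).

Cell `prim-pcint`, seat `prim-pcint-2` (gen 2); memo `run/shared/lean/prim/pcint/INTERVAL-PLAN.md` §15.  Does NOT build on p205010.
Assembles the kernel-checked row blocks (`…KernNFZ4B8Check1..30`) — rows read from the search tree, converted once by `WinK.all_rowOKBK_of_tree` after checking `ordered` and `toList = tbl` by `decide`, closes the enumeration (`WinK.all_nfCodes_of_nfCodesIn`,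
`WinK.allRange_nfOKB_of_nfCodes`) and applies `WinK.le_criticalProb_of_checkBK` (`…PcintWinKernelSymCert`).
No external certificate, no `native_decide`; axioms standard.
-/

namespace Summit.CriticalPhenomena.PercolationContinuityZ3.Theorems.Pcint

open Literature.Probability.Percolation Literature.Probability.LatticeModels NFZ4B8

set_option maxHeartbeats 0 in
/-- All Collatz–Wielandt rows on the normal forms of the `2097152` window codes check. [folklore] -/
theorem NFZ4B8.chkAll : (WinK.nfCodes 4 7).all (WinK.rowOKBK 4 6 1505 10115 9887 99999 tbl 49109) = true :=
  WinK.all_nfCodes_of_nfCodesIn (hi := 2097152) (WinK.all_of_allB (fuel := 20) (by decide +kernel))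
    (WinK.all_rowOKBK_of_tree (t := WinK.KT.ofListF 13 tbl) (by decide +kernel) (by decide +kernel) (WinK.all_nfCodesIn_append (WinK.all_nfCodesIn_append (WinK.all_nfCodesIn_append (WinK.all_nfCodesIn_append (WinK.all_nfCodesIn_append (WinK.all_nfCodesIn_append (WinK.all_nfCodesIn_append (WinK.all_nfCodesIn_append (WinK.all_nfCodesIn_append (WinK.all_nfCodesIn_append (WinK.all_nfCodesIn_append (WinK.all_nfCodesIn_append (WinK.all_nfCodesIn_append (WinK.all_nfCodesIn_append (WinK.all_nfCodesIn_append (WinK.all_nfCodesIn_append (WinK.all_nfCodesIn_append (WinK.all_nfCodesIn_append (WinK.all_nfCodesIn_append (WinK.all_nfCodesIn_append (WinK.all_nfCodesIn_append (WinK.all_nfCodesIn_append (WinK.all_nfCodesIn_append (WinK.all_nfCodesIn_append (WinK.all_nfCodesIn_append (WinK.all_nfCodesIn_append (WinK.all_nfCodesIn_append (WinK.all_nfCodesIn_append (WinK.all_nfCodesIn_append chkFile_1 chkFile_2) chkFile_3) chkFile_4) chkFile_5) chkFile_6) chkFile_7) chkFile_8) chkFile_9) chkFile_10) chkFile_11)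 chkFile_12) chkFile_13) chkFile_14) chkFile_15) chkFile_16) chkFile_17) chkFile_18) chkFile_19) chkFile_20) chkFile_21) chkFile_22) chkFile_23) chkFile_24) chkFile_25) chkFile_26) chkFile_27) chkFile_28) chkFile_29) chkFile_30))

/-- **`p_c^bond(ℤ⁴) ≥ 0.1505`** (kernel-checked B3r window certificate on normal forms, memory 8 (7-step windows; 9696 first-use normal forms of 2097152 codes); printed best lower bound 0.1470 (Pönitz–Tittmann 2000 + Hammersley)). [folklore] -/
theorem criticalProb_Z4_ge_01505 : (0.1505 : ℝ) ≤ criticalProb (zdGraph 4) 0 := by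
  have h := WinK.le_criticalProb_of_checkBK (d := 4) (m := 6) (pn := 1505) (R := 10115) (S := 9887) (lamN := 99999)
      (tbl := tbl) (dflt := 49109) (vlo := 49109) (vhi := 100000) (by norm_num) (by norm_num) (by norm_num) (by norm_num)
      (by norm_num) (by norm_num) (by norm_num) (by norm_num) tbl_bounds (by norm_num) (by norm_num)
      (WinK.allRange_nfOKB_of_nfCodes chkAll)
  have e : ((1505 : ℕ) : ℝ) / 10 ^ 4 = 0.1505 := by norm_num
  rw [e] at h
  exact h

end Summit.CriticalPhenomena.PercolationContinuityZ3.Theorems.Pcint
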